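import Summits.NavierStokesRegularity.NavierStokesRegularity.Theorems.ScenarioCensusRowF1StretchedZoom
import Summits.NavierStokesRegularity.NavierStokesRegularity.Theorems.ScenarioCensusRowF1ColumnarTransfer
import HarnessLib

/-!
# LINE «stretched-top» port, part 3/4: the transfer — fast points, closed scale-invariant conditions, analytic density, the Lamb weight

Re-homed for the scenario census (typer seat ns-census-typer-1 g7; the cells F1sx ⊇ F1ss ⊇ F1rg, F1gsx, F1lb are MEMBERS OF RECORD «DECIDED IN KERNEL IN
FILES» of row F1 since census v1.68 (critic idea-crit-3 g6 PASS 19:59:58Z; ref ns-census-ref g8 PRE-CHECK ✓ §13.14 [2/6]; lit §21.20); this port makes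
them TREE-decided): VERBATIM PORT of ns-idea-3 LINE 16 «stretched-top», `pub/ideators/ns-idea-3/lines/stretched-top/line-stretched-top.lean` sha16
a94533c1db73adac (912 l., lean check rc 0, 0 sorry), split for the 400-line rule into `ScenarioCensusRowF1Stretched` (§1) → `…StretchedZoom` (§2–§3) →
`…StretchedTransfer` (§4) → `…StretchedTop` (§5 + census KEYS).  Lean text VERBATIM in namespace `…Theorems.ScenarioCensus.StretchedTop` (the line's
`…Cruxes.ScenarioCensusRowF1.StretchedTopLine` re-homed); port edits: `@[conjecture]` on the residual `StretchingSlack` (≡ `ScenarioCensus.Row_F1`, OPEN).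

No census VALUE is moved here (row F1 stays OPEN-WITH-LINE; the members become TREE-decided by name); NS regularity is NOT proved; `Row_F1` is
untouched (zero movement, `stretchingSlack_iff_rowF1`); no summit statement is proved by this file. Lemmas that restate already-landed tree declarations are taken BY NAME (gate lint `dedup.landed`): `tendsto_physicalTime` = `ColumnarTop.tendsto_physicalTime`, `eventually_fast` = `ColumnarTop.eventually_fast`.
-/

-- the summit and its single problem share the name `NavierStokesRegularity` (D-0017 nested layout)
set_option linter.dupNamespace false

noncomputable section

open MeasureTheory Set Function Filter TopologicalSpace Metric
open scoped Topology NNReal ENNReal InnerProductSpace RealInnerProductSpace Laplacian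

namespace Summit.NavierStokesRegularity.NavierStokesRegularity.Theorems.ScenarioCensus.StretchedTop

open Literature.Analysis Literature.Analysis.FluidPDE
open Summit.NavierStokesRegularity.NavierStokesRegularity.Theorems

/-! ## §4 The transfer: fast points, closed scale-invariant conditions, analytic density, the Lamb weight -/

-- `tendsto_physicalTime`: the line restates the tree's `ColumnarTop.tendsto_physicalTime`; taken BY NAME (gate lint dedup.landed).

/-- The square root of the physical time lag: `√(T − τ_j) = c_j √β √(−t)`. -/
theorem sqrt_timeLag {T β t : ℝ} (hβ : 0 < β) (_ht : t < 0) {c : ℕ → ℝ} (hcpos : ∀ j, 0 < c j) (j : ℕ) :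
    Real.sqrt (T - (T + c j ^ 2 * β * t)) = c j * Real.sqrt β * Real.sqrt (-t) := by
  have e : T - (T + c j ^ 2 * β * t) = c j ^ 2 * β * (-t) := by ring
  rw [e, Real.sqrt_mul (by positivity : (0 : ℝ) ≤ c j ^ 2 * β), Real.sqrt_mul (sq_nonneg _),
    Real.sqrt_sq (hcpos _).le]

-- `eventually_fast`: the line restates the tree's `ColumnarTop.eventually_fast`; taken BY NAME (gate lint dedup.landed).

/-- **CLOSED TRANSFER** (the new step).  Let `P w L` be a condition on a time weight `w` and a velocity
gradient `L` which is CLOSED in `L` and SCALE-INVARIANT, `P (κ w) (κ⁻¹ L) ↔ P w L` for `κ > 0` (i.e. a closed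
condition on the dimensionless gradient `w L`, possibly inhomogeneous).  If `P (T − t') (∇u(t', x))` holds at
the `Λ(t')`-fast points eventually as `t' ↑ T`, `Λ` subcritical, then the zoom limit satisfies
`P (−t) (∇W(t, y))` at every `y` with `W(t, y) ≠ 0`: the zoom gradient at `(t, y)` is `κ_j ∇u(τ_j, x_j)` with
`κ_j = c_j² α R = c_j² β = (T − τ_j)/(−t)`, and the condition is closed under the limit `j → ∞`. -/
theorem closed_transfer {T : ℝ} {u : ℝ → E3 → E3} {x₀ : E3} {α β R : ℝ} {c : ℕ → ℝ} {W : ℝ → E3 → E3}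
    (hα : 0 < α) (hβ : 0 < β) (hαR : α * R = β) (hcpos : ∀ j, 0 < c j) (hclim : Tendsto c atTop (𝓝 0))
    (hpt : ∀ t < 0, ∀ y : E3,
      Tendsto (fun j => (c j * α) • u (T + c j ^ 2 * β * t) (x₀ + (c j * R) • y)) atTop (𝓝 (W t y)))
    (hgrad : ∀ t < 0, ∀ y : E3,
      Tendsto (fun j => (c j * α * (c j * R)) • fderiv ℝ (u (T + c j ^ 2 * β * t)) (x₀ + (c j * R) • y))
        atTop (𝓝 (fderiv ℝ (W t) y)))
    {P : ℝ → (E3 →L[ℝ] E3) → Prop} (hPc : ∀ w : ℝ, IsClosed {L : E3 →L[ℝ] E3 | P w L})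
    (hPs : ∀ κ : ℝ, 0 < κ → ∀ (w : ℝ) (L : E3 →L[ℝ] E3), P (κ * w) (κ⁻¹ • L) ↔ P w L)
    {Λ : ℝ → ℝ} (hΛ : IsSubcriticalLevel T Λ)
    (hH : ∀ᶠ t' in 𝓝[<] T, ∀ x : E3, Λ t' < ‖u t' x‖ → P (T - t') (fderiv ℝ (u t') x)) :
    ∀ t < 0, ∀ y, W t y ≠ 0 → P (-t) (fderiv ℝ (W t) y) := by
  intro t ht y hne
  have hfast := ColumnarTop.eventually_fast hα hβ hcpos hclim hpt hΛ ht hne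
  have hτ := ColumnarTop.tendsto_physicalTime (T := T) hβ ht hcpos hclim
  refine (hPc (-t)).mem_of_tendsto (hgrad t ht y) ?_
  filter_upwards [hfast, hτ.eventually hH] with j hj1 hj2
  have hb := hj2 _ hj1
  have hcj : 0 < c j := hcpos j
  have hκ0 : 0 < c j ^ 2 * β := by positivity
  have eT : T - (T + c j ^ 2 * β * t) = c j ^ 2 * β * (-t) := by ring
  have eG : fderiv ℝ (u (T + c j ^ 2 * β * t)) (x₀ + (c j * R) • y) =
      (c j ^ 2 * β)⁻¹ • ((c j * α * (c j * R)) •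
        fderiv ℝ (u (T + c j ^ 2 * β * t)) (x₀ + (c j * R) • y)) := by
    rw [smul_smul]
    have e1 : (c j ^ 2 * β)⁻¹ * (c j * α * (c j * R)) = 1 := by
      rw [show c j * α * (c j * R) = c j ^ 2 * (α * R) by ring, hαR]
      exact inv_mul_cancel₀ hκ0.ne'
    rw [e1, one_smul]
  rw [eT, eG, hPs _ hκ0] at hb
  exact hb

/-- **Analytic density**: a CLOSED set of points containing the nonzero set of a NONTRIVIAL slice of `𝒦_C`
is everything (the slice is real-analytic, so its zero set has empty interior unless the slice vanishes). -/
theorem forall_of_forall_ne_zero {C : ℝ} {W : ℝ → E3 → E3} (hW : IsTypeIAncientMild C W) {t : ℝ}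
    (ht : t < 0) {S : Set E3} (hS : IsClosed S) (h : ∀ y, W t y ≠ 0 → y ∈ S) (hnt : ∃ z, W t z ≠ 0) :
    ∀ y, y ∈ S := by
  obtain ⟨z, hz⟩ := hnt
  by_contra hno
  push Not at hno
  obtain ⟨y, hy⟩ := hno
  have hev : W t =ᶠ[𝓝 y] 0 := by
    filter_upwards [hS.isOpen_compl.mem_nhds hy] with y' hy'
    by_contra hne
    exact hy' (h y' hne)
  have key := (hW.analyticOnNhd_slice_univ ht).eqOn_zero_of_preconnected_of_eventuallyEq_zero
    isPreconnected_univ (mem_univ y) hev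
  exact hz (key (mem_univ z))

/-- Scaling of the vortex-stretching numerator: `⟪(a L)(curl (a L)), curl (a L)⟫ = a³ ⟪L (curl L), curl L⟫`. -/
theorem stretchNum_smul (a : ℝ) (L : E3 →L[ℝ] E3) :
    ⟪(a • L) (curlCLM (a • L)), curlCLM (a • L)⟫_ℝ = a ^ 3 * ⟪L (curlCLM L), curlCLM L⟫_ℝ := by
  rw [map_smul, _root_.smul_apply, map_smul, real_inner_smul_left, real_inner_smul_right,
    real_inner_smul_left]
  ring

/-- Scaling of the vorticity norm: `‖curl (a L)‖² = a² ‖curl L‖²`. -/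
theorem curlNormSq_smul (a : ℝ) (L : E3 →L[ℝ] E3) :
    ‖curlCLM (a • L)‖ ^ 2 = a ^ 2 * ‖curlCLM L‖ ^ 2 := by
  rw [map_smul, norm_smul, mul_pow, Real.norm_eq_abs, sq_abs]

/-- The vortex-stretching condition `w ⟪L ω_L, ω_L⟫ ≤ θ ‖ω_L‖²` is closed in `L`. -/
theorem isClosed_stretchCond (w θ : ℝ) :
    IsClosed {L : E3 →L[ℝ] E3 | w * ⟪L (curlCLM L), curlCLM L⟫_ℝ ≤ θ * ‖curlCLM L‖ ^ 2} := by
  have h1 : Continuous fun L : E3 →L[ℝ] E3 => w * ⟪L (curlCLM L), curlCLM L⟫_ℝ :=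
    continuous_const.mul ((continuous_id.clm_apply curlCLM.continuous).inner curlCLM.continuous)
  have h2 : Continuous fun L : E3 →L[ℝ] E3 => θ * ‖curlCLM L‖ ^ 2 :=
    continuous_const.mul ((curlCLM.continuous.norm).pow 2)
  exact isClosed_le h1 h2

/-- The vortex-stretching condition is scale-invariant. -/
theorem stretchCond_smul_iff {κ : ℝ} (hκ : 0 < κ) (w θ : ℝ) (L : E3 →L[ℝ] E3) :
    (κ * w * ⟪(κ⁻¹ • L) (curlCLM (κ⁻¹ • L)), curlCLM (κ⁻¹ • L)⟫_ℝ ≤ θ * ‖curlCLM (κ⁻¹ • L)‖ ^ 2) ↔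
      (w * ⟪L (curlCLM L), curlCLM L⟫_ℝ ≤ θ * ‖curlCLM L‖ ^ 2) := by
  rw [stretchNum_smul, curlNormSq_smul]
  have hk : 0 < (κ⁻¹) ^ 2 := by positivity
  have e1 : κ * w * ((κ⁻¹) ^ 3 * ⟪L (curlCLM L), curlCLM L⟫_ℝ) =
      (κ⁻¹) ^ 2 * (w * ⟪L (curlCLM L), curlCLM L⟫_ℝ) := by
    field_simp
  have e2 : θ * ((κ⁻¹) ^ 2 * ‖curlCLM L‖ ^ 2) = (κ⁻¹) ^ 2 * (θ * ‖curlCLM L‖ ^ 2) := by ring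
  rw [e1, e2]
  exact ⟨fun h => le_of_mul_le_mul_left h hk, fun h => mul_le_mul_of_nonneg_left h hk.le⟩

/-- The vortex-stretching condition is closed in the point `y` along a `C¹` slice. -/
theorem isClosed_stretchCond_slice {C : ℝ} {W : ℝ → E3 → E3} (hW : IsTypeIAncientMild C W) {s : ℝ}
    (hs : s < 0) (w θ : ℝ) :
    IsClosed {y : E3 | w * ⟪fderiv ℝ (W s) y (curl (W s) y), curl (W s) y⟫_ℝ ≤ θ * ‖curl (W s) y‖ ^ 2} := by
  have hD : Continuous (fderiv ℝ (W s)) := (hW.contDiff_slice hs).continuous_fderiv (by simp)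
  have hcurl : Continuous (curl (W s)) := by
    rw [curl_eq_curlCLM_comp]
    exact curlCLM.continuous.comp hD
  have h1 : Continuous fun y : E3 => w * ⟪fderiv ℝ (W s) y (curl (W s) y), curl (W s) y⟫_ℝ :=
    continuous_const.mul ((hD.clm_apply hcurl).inner hcurl)
  have h2 : Continuous fun y : E3 => θ * ‖curl (W s) y‖ ^ 2 := continuous_const.mul ((hcurl.norm).pow 2)
  exact isClosed_le h1 h2

/-- **Transfer of sub-critical stretching**: under the zoom package, sub-critical vortex stretching on a
subcritical top passes to the limit EVERYWHERE: `(−s) ⟪∇W ω_W, ω_W⟫ ≤ θ ‖ω_W‖²` for all `s < 0`, `y`. -/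
theorem subcriticalStretching_transfer {T : ℝ} {u : ℝ → E3 → E3} {x₀ : E3} {α β R : ℝ} {c : ℕ → ℝ}
    {C : ℝ} {W : ℝ → E3 → E3}
    (hα : 0 < α) (hβ : 0 < β) (hαR : α * R = β) (hcpos : ∀ j, 0 < c j) (hclim : Tendsto c atTop (𝓝 0))
    (hW : IsTypeIAncientMild C W)
    (hpt : ∀ t < 0, ∀ y : E3,
      Tendsto (fun j => (c j * α) • u (T + c j ^ 2 * β * t) (x₀ + (c j * R) • y)) atTop (𝓝 (W t y)))
    (hgrad : ∀ t < 0, ∀ y : E3,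
      Tendsto (fun j => (c j * α * (c j * R)) • fderiv ℝ (u (T + c j ^ 2 * β * t)) (x₀ + (c j * R) • y))
        atTop (𝓝 (fderiv ℝ (W t) y)))
    {Λ : ℝ → ℝ} (hΛ : IsSubcriticalLevel T Λ) {θ : ℝ} (hH : HasSubcriticalStretchingAt T Λ θ u) :
    ∀ s < 0, ∀ y : E3,
      (-s) * ⟪fderiv ℝ (W s) y (curl (W s) y), curl (W s) y⟫_ℝ ≤ θ * ‖curl (W s) y‖ ^ 2 := by
  -- the closed, scale-invariant condition
  have hQ := closed_transfer hα hβ hαR hcpos hclim hpt hgrad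
    (P := fun w L => w * ⟪L (curlCLM L), curlCLM L⟫_ℝ ≤ θ * ‖curlCLM L‖ ^ 2)
    (fun w => isClosed_stretchCond w θ) (fun κ hκ w L => stretchCond_smul_iff hκ w θ L) hΛ
    (by
      filter_upwards [hH] with t' ht' x hx
      simpa only [curl_eq_curlCLM] using ht' x hx)
  intro s hs y
  by_cases hnt : ∃ z, W s z ≠ 0
  · exact forall_of_forall_ne_zero hW hs (isClosed_stretchCond_slice hW hs (-s) θ)
      (fun y' hy' => by simpa only [mem_setOf_eq, curl_eq_curlCLM] using hQ s hs y' hy') hnt y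
  · push Not at hnt
    have h0 : W s = fun _ => (0 : E3) := funext hnt
    rw [h0, curl_zero_field, fderiv_const_apply]
    simp

/-- Scaling of the Lamb vector: `curl(a L) × (b v) = (a b) (curl L × v)`. -/
theorem lamb_smul (a b : ℝ) (L : E3 →L[ℝ] E3) (v : E3) :
    cross (curlCLM (a • L)) (b • v) = (a * b) • cross (curlCLM L) v := by
  show crossCLM (curlCLM (a • L)) (b • v) = (a * b) • crossCLM (curlCLM L) v
  rw [map_smul curlCLM, map_smul crossCLM, _root_.smul_apply, map_smul, smul_smul]

/-- **Transfer of Lamb slack**: under the zoom package, Lamb slack on a subcritical top makes the Lamb vector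
of the limit vanish at every point with `W(t, y) ≠ 0` (the weight `(T − t')^{3/2}` of `ω × u` is the product of
the value weight `c_j α` and the gradient weight `c_j² α R`, up to the constant `α/√β`). -/
theorem lambSlack_transfer {T : ℝ} {u : ℝ → E3 → E3} {x₀ : E3} {α β R : ℝ} {c : ℕ → ℝ} {W : ℝ → E3 → E3}
    (hα : 0 < α) (hβ : 0 < β) (hαR : α * R = β) (hcpos : ∀ j, 0 < c j) (hclim : Tendsto c atTop (𝓝 0))
    (hpt : ∀ t < 0, ∀ y : E3,
      Tendsto (fun j => (c j * α) • u (T + c j ^ 2 * β * t) (x₀ + (c j * R) • y)) atTop (𝓝 (W t y)))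
    (hgrad : ∀ t < 0, ∀ y : E3,
      Tendsto (fun j => (c j * α * (c j * R)) • fderiv ℝ (u (T + c j ^ 2 * β * t)) (x₀ + (c j * R) • y))
        atTop (𝓝 (fderiv ℝ (W t) y)))
    {Λ : ℝ → ℝ} (hΛ : IsSubcriticalLevel T Λ) (hH : HasLambSlackAt T Λ u) :
    ∀ t < 0, ∀ y, W t y ≠ 0 → cross (curl (W t) y) (W t y) = 0 := by
  intro t ht y hne
  have ht' : 0 < -t := neg_pos.2 ht
  set K : ℝ := α / Real.sqrt β with hK
  have hsb : 0 < Real.sqrt β := Real.sqrt_pos.2 hβ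
  have hK0 : 0 < K := div_pos hα hsb
  -- the rescaled Lamb vectors converge (continuity of `(L, v) ↦ curl L × v`; no unfolding of the CLMs)
  have hF : Continuous fun p : (E3 →L[ℝ] E3) × E3 => crossCLM (curlCLM p.1) p.2 :=
    (crossCLM.continuous.comp (curlCLM.continuous.comp continuous_fst)).clm_apply continuous_snd
  have h1 := (hF.tendsto (fderiv ℝ (W t) y, W t y)).comp ((hgrad t ht y).prodMk_nhds (hpt t ht y))
  have h2 := (h1.norm).const_mul ((-t) * Real.sqrt (-t))
  simp only [Function.comp_def, crossCLM_apply] at h2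
  have hlim : Tendsto (fun j => (-t) * Real.sqrt (-t) *
      ‖cross (curlCLM ((c j * α * (c j * R)) • fderiv ℝ (u (T + c j ^ 2 * β * t)) (x₀ + (c j * R) • y)))
        ((c j * α) • u (T + c j ^ 2 * β * t) (x₀ + (c j * R) • y))‖) atTop
      (𝓝 ((-t) * Real.sqrt (-t) * ‖cross (curlCLM (fderiv ℝ (W t) y)) (W t y)‖)) := h2
  rw [← curl_eq_curlCLM] at hlim
  have hfast := ColumnarTop.eventually_fast hα hβ hcpos hclim hpt hΛ ht hne
  have hτ := ColumnarTop.tendsto_physicalTime (T := T) hβ ht hcpos hclim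
  -- `(-t)^{3/2} ‖ω_W × W‖(t, y) ≤ ε'` for every `ε' > 0`
  have hle : ∀ ε' : ℝ, 0 < ε' → (-t) * Real.sqrt (-t) * ‖cross (curl (W t) y) (W t y)‖ ≤ ε' := by
    intro ε' hε'
    refine le_of_tendsto hlim ?_
    filter_upwards [hfast, hτ.eventually (hH (ε' / K) (div_pos hε' hK0))] with j hj1 hj2
    have hb := hj2 _ hj1
    rw [sqrt_timeLag hβ ht hcpos j, show T - (T + c j ^ 2 * β * t) = c j ^ 2 * β * (-t) by ring] at hb
    have hcj : 0 < c j := hcpos j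
    have hw3 : 0 < c j * α * (c j * R) * (c j * α) := by
      have hR : 0 < R := by
        have : 0 < α * R := by rw [hαR]; exact hβ
        exact pos_of_mul_pos_right this hα.le
      positivity
    rw [lamb_smul, norm_smul, Real.norm_eq_abs, abs_of_pos hw3, ← curl_eq_curlCLM]
    have e2 : ∀ X : ℝ, (-t) * Real.sqrt (-t) * (c j * α * (c j * R) * (c j * α) * X) =
        K * (c j ^ 2 * β * (-t) * (c j * Real.sqrt β * Real.sqrt (-t)) * X) := by
      intro X
      rw [show c j * α * (c j * R) * (c j * α) = c j ^ 3 * α * (α * R) by ring, hαR, hK]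
      field_simp
    rw [e2]
    calc K * (c j ^ 2 * β * (-t) * (c j * Real.sqrt β * Real.sqrt (-t)) *
          ‖cross (curl (u (T + c j ^ 2 * β * t)) (x₀ + (c j * R) • y))
            (u (T + c j ^ 2 * β * t) (x₀ + (c j * R) • y))‖)
        ≤ K * (ε' / K) := mul_le_mul_of_nonneg_left hb hK0.le
      _ = ε' := by field_simp
  have h0 : (-t) * Real.sqrt (-t) * ‖cross (curl (W t) y) (W t y)‖ ≤ 0 :=
    le_of_forall_pos_le_add fun ε' hε' => by rw [zero_add]; exact hle ε' hε'
  have hw : 0 < (-t) * Real.sqrt (-t) := mul_pos ht' (Real.sqrt_pos.2 ht')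
  have hn : ‖cross (curl (W t) y) (W t y)‖ ≤ 0 := by
    by_contra hpos
    push Not at hpos
    exact absurd h0 (not_le.2 (mul_pos hw hpos))
  exact norm_eq_zero.1 (le_antisymm hn (norm_nonneg _))

end Summit.NavierStokesRegularity.NavierStokesRegularity.Theorems.ScenarioCensus.StretchedTop

end
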